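import Literature.AlgebraicGeometry.HodgeTheory.CMHodgeGroupLieSocket
import Literature.AlgebraicGeometry.HodgeTheory.CMHodgeGroupPowersHodgeClasses
import Literature.AlgebraicGeometry.HodgeTheory.CMFieldSkewArithmetic
import HarnessLib

/-!
# The `Hg = U_E ∩ SU_K` socket for a CM field `E = ℚ[φ]`, Lie form: lifting the factors `𝔰𝔩(W_σ) ⊕ 0` and the ONE central
# direction carried by the Hodge operator `Θ` gives every `φ_ℂ`-commuting `ψ_ℂ`-skew operator whose block traces are
# proportional to those of `Θ` (Moonen–Zarhin 1998 §4 Remark (1), 1999 (1.8)/(2.3); Deligne LNM 900 §4)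

Family `hodge`, layer `Literature/AlgebraicGeometry/HodgeTheory` (companion of `CMHodgeGroupLieSocket`). UNCONDITIONAL; theorems
only, no definition, no named fact, no `sorry`. Written for the cell `pub-hodgeav-hg6` (req-37 (A) Q2b, TABLE X ROW 11 =
`IV(2,1).kE0`: simple abelian sixfolds with `End⁰ = E` a biquadratic CM field `K·E₀`, `dim_E H¹ = 3`, CM pattern `(2,1)+(1,2)`,
of `K`-Weil type `(3,3)`; design note `HOME/jobs/ROW11-Esquare-eng4g8/DESIGN.md`, brick R11-1). HONEST FRAMING of that cell:
HC / HC_AV / HC_CM / H2 NOT proved — this file is linear algebra of polarized weight-one `ℚ`-Hodge structures and discharges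
nothing by itself.

SETTING as in `CMThetaSocket.mem_spanC_of_lift_of_centre`: `H` effective polarized of weight `1`, `E = End_Hdg(V) = ℚ[φ]`
(`hE`), a CM type `μ : ι → ℂ` of eigenvalues of `φ_ℂ` with multiplicity `n₀` (`hrank`) whose `2|ι|` eigenspaces span `V_ℂ`
(`htop`), an admissible `𝔤 ⊆ End_ℚ(V)` (commuting with `End_Hdg(V)`, `ψ`-skew) with `Θ ∈ 𝔤_ℂ`, and the LIFT property
(every traceless endomorphism of `W_{μ k}` is induced by an element of `𝔤_ℂ` killing the other `W_{μ j}`).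
* §1 **`CMThetaSocket.exists_centre_of_theta`** — THE CENTRAL DIRECTION OF `Θ`: with LIFT, some `C ∈ 𝔤_ℂ` acts on every
  `W_{μ k}` by the scalar `tr(Θ|_{W_{μ k}}) / n₀ = (dim W_{μ k}^{1,0} − dim W_{μ k}^{0,1}) / n₀` (subtract from `Θ` the lifts of
  the traceless parts of its blocks). No hypothesis on the centre of `𝔤` is used or produced beyond this one direction.
* §2 **`CMThetaSocket.mem_spanC_of_lift_of_trace_eq_smul`** — THE `SU`-SOCKET: with LIFT, every `φ_ℂ`-commuting
  `ψ_ℂ`-skew `Y` whose block traces are a COMMON multiple of those of `Θ` (`tr(Y|_{W_{μ k}}) = λ · tr(Θ|_{W_{μ k}})` for all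
  `k`) lies in `𝔤_ℂ` (§1 + the traceless lifts + `CMThetaSocket.eq_zero_of_forall_eigenspace`). For TWO places `k₁ ≠ k₂` with
  `tr(Θ|_{W₁}) + tr(Θ|_{W₂}) = 0 ≠ tr(Θ|_{W₁})` (the `K`-Weil pattern `(2,1)+(1,2)`: `(2−1) + (1−2) = 0`) this is
  **`CMThetaSocket.mem_spanC_of_lift_of_trace_add_eq_zero`**: every `φ_ℂ`-commuting `ψ_ℂ`-skew `Y` with
  `tr(Y|_{W₁}) + tr(Y|_{W₂}) = 0` lies in `𝔤_ℂ` — «`Lie Hg ⊗ ℂ ⊇ 𝔲_E ∩ 𝔰𝔲_K`», the Lie hypothesis `hSU` of the cell's B5a-E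
  socket (`WeilTypeCMFieldHodgeGroupUEOfLie` §3) at the level of Hodge structures, GIVEN the lifts. The LIFT input for row 11
  is the cell's n₀ = 3 NoTwist brick (eng-5 lineage) plus the row-11 twist exclusion; nothing of that is claimed here.

## References
* [MoonenZarhin1998WeilClasses] B. Moonen, Yu. Zarhin, J. reine angew. Math. 496 (1998), §4 Remark (1) (`Z(Hdg) ⊂ U_E`,
  `Hdg ⊂ SU_K` when `W_K` is Hodge).
* [MoonenZarhin1999LowDim] B. Moonen, Yu. Zarhin, Math. Ann. 315 (1999), §1 (1.8), §2 (2.3).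
* [Deligne1982HodgeCycles] P. Deligne, LNM 900 (1982), I §3 Prop. 3.4, §4 (p. 30).
* [Ribet1983] K. A. Ribet, Amer. J. Math. 105 (1983), Thm. 0, §3.
-/

noncomputable section

open scoped TensorProduct
open Module

namespace Literature.AlgebraicGeometry.Motives

namespace HodgeStructure

universe u

variable {V : Type u} [AddCommGroup V] [Module ℚ V] {n : ℤ}

/-- The traceless part with the explicit scalar: `T = (T − (tr T / d)·1) + (tr T / d)·1`, `d = dim ≠ 0`. [folklore] -/
private theorem CMThetaSocket.trace_sub_div_smul_one {K M : Type*} [Field K] [AddCommGroup M] [Module K M]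
    [FiniteDimensional K M] (hd : (Module.finrank K M : K) ≠ 0) (T : Module.End K M) :
    LinearMap.trace K M (T - (LinearMap.trace K M T / (Module.finrank K M : K)) • 1) = 0 := by
  rw [map_sub, map_smul, LinearMap.trace_one, smul_eq_mul, div_mul_cancel₀ _ hd, sub_self]

/-! ### §1 The central direction carried by `Θ` -/

/-- **THE CENTRAL DIRECTION OF `Θ`.** `H` effective polarized of weight `1`, `E = End_Hdg(V) = ℚ[φ]`, `μ` a CM type of `φ_ℂ`
with all `W_{μ k}` of dimension `n₀ ≠ 0`, `𝔤` admissible with `Θ ∈ 𝔤_ℂ` and the LIFT property. Then some `C ∈ 𝔤_ℂ` acts on every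
`W_{μ k}` by the scalar `(dim W_{μ k}^{1,0} − dim W_{μ k}^{0,1}) / n₀ = tr(Θ|_{W_{μ k}}) / n₀`: `C = Θ − Σ_k X_k` with `X_k ∈ 𝔤_ℂ`
the lift of the traceless part of `Θ|_{W_{μ k}}` killing the other blocks. (Moonen–Zarhin: the centre of `Hdg` contains the
`E`-component of the Hodge cocharacter; here only that one direction.) [cite: MoonenZarhin1998WeilClasses, §4 Remark (1)]
[cite: MoonenZarhin1999LowDim, §1 (1.8)] [cite: Deligne1982HodgeCycles, §4 (p. 30)] -/
theorem CMThetaSocket.exists_centre_of_theta [Module.Finite ℚ V] [HodgeTensorFacts.{u, u}] {ι : Type} [Fintype ι]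
    [DecidableEq ι] (H : HodgeStructure V n) (hn : n = 1) (heff : H.IsEffective)
    {φ : Module.End ℚ V} (hφE : φ ∈ H.endAlg) {n₀ : ℕ} (hn₀ : n₀ ≠ 0) (μ : ι → ℂ)
    (hrank : ∀ k, Module.finrank ℂ ↥(Module.End.eigenspace (φ.baseChange ℂ) (μ k) ⊓ H.piece 1 0) +
      Module.finrank ℂ ↥(Module.End.eigenspace (φ.baseChange ℂ) (μ k) ⊓ H.piece 0 1) = n₀)
    (𝔤 : Submodule ℚ (Module.End ℚ V))
    (hcomm : ∀ X ∈ 𝔤, ∀ a : H.endAlg, X * (a : Module.End ℚ V) = (a : Module.End ℚ V) * X)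
    {Θ : Module.End ℂ (ℂ ⊗[ℚ] V)} (hΘ : ∀ p, ∀ x ∈ H.piece p (n - p), Θ x = ((2 * p - n : ℤ) : ℂ) • x)
    (hΘ𝔤 : Θ ∈ spanC 𝔤)
    (hlift : ∀ k, ∀ Z : Module.End ℂ ↥(Module.End.eigenspace (φ.baseChange ℂ) (μ k)),
      LinearMap.trace ℂ _ Z = 0 → ∃ X ∈ spanC 𝔤,
        (∀ w : ↥(Module.End.eigenspace (φ.baseChange ℂ) (μ k)), X w = Z w) ∧
        ∀ j, j ≠ k → ∀ w ∈ Module.End.eigenspace (φ.baseChange ℂ) (μ j), X w = 0) :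
    ∃ C ∈ spanC 𝔤, ∀ k, ∀ w ∈ Module.End.eigenspace (φ.baseChange ℂ) (μ k),
      C w = (((Module.finrank ℂ ↥(Module.End.eigenspace (φ.baseChange ℂ) (μ k) ⊓ H.piece 1 0) : ℂ) -
        (Module.finrank ℂ ↥(Module.End.eigenspace (φ.baseChange ℂ) (μ k) ⊓ H.piece 0 1) : ℂ)) / (n₀ : ℂ)) • w := by
  classical
  set F := φ.baseChange ℂ with hF
  have hΘφ : Θ * F = F * Θ := UnitaryTheta.commute_of_mem_spanC H hφE hcomm hΘ𝔤
  have hΘW : ∀ k, ∀ w ∈ Module.End.eigenspace F (μ k), Θ w ∈ Module.End.eigenspace F (μ k) := fun k w hw =>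
    UnitaryTheta.apply_mem_eigenspace_of_commute hΘφ hw
  have hfin : ∀ k, Module.finrank ℂ ↥(Module.End.eigenspace F (μ k)) = n₀ := fun k => by
    rw [hF, CMTheta.finrank_eigenspace_eq_add H hn heff hφE, hrank k]
  have hn₀C : (n₀ : ℂ) ≠ 0 := Nat.cast_ne_zero.2 hn₀
  -- the scalar of `Θ` on `W_{μ k}`
  set θ : ι → ℂ := fun k => (((Module.finrank ℂ ↥(Module.End.eigenspace F (μ k) ⊓ H.piece 1 0) : ℂ) -
    (Module.finrank ℂ ↥(Module.End.eigenspace F (μ k) ⊓ H.piece 0 1) : ℂ)) / (n₀ : ℂ)) with hθdef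
  have htrΘ : ∀ k, LinearMap.trace ℂ _ (Θ.restrict (hΘW k)) = θ k * (n₀ : ℂ) := fun k => by
    rw [CMArith.trace_restrict_theta H hn heff hΘ (hΘW k), hθdef]
    simp only
    rw [div_mul_cancel₀ _ hn₀C]
  -- lift the traceless part of each block of `Θ`
  have key : ∀ k, ∃ X ∈ spanC 𝔤, (∀ w ∈ Module.End.eigenspace F (μ k), X w = Θ w - θ k • w) ∧
      ∀ j, j ≠ k → ∀ w ∈ Module.End.eigenspace F (μ j), X w = 0 := by
    intro k
    haveI : FiniteDimensional ℂ ↥(Module.End.eigenspace F (μ k)) := inferInstance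
    have hd : (Module.finrank ℂ ↥(Module.End.eigenspace F (μ k)) : ℂ) ≠ 0 := by rw [hfin k]; exact hn₀C
    set Z : Module.End ℂ ↥(Module.End.eigenspace F (μ k)) :=
      Θ.restrict (hΘW k) - (LinearMap.trace ℂ _ (Θ.restrict (hΘW k)) /
        (Module.finrank ℂ ↥(Module.End.eigenspace F (μ k)) : ℂ)) • 1 with hZ
    obtain ⟨X, hX𝔤, hXk, hXj⟩ := hlift k Z (CMThetaSocket.trace_sub_div_smul_one hd _)
    refine ⟨X, hX𝔤, fun w hw => ?_, hXj⟩
    have h := hXk ⟨w, hw⟩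
    rw [hZ, LinearMap.sub_apply, LinearMap.smul_apply, Module.End.one_apply, Submodule.coe_sub, Submodule.coe_smul,
      LinearMap.coe_restrict_apply, htrΘ k, hfin k, mul_div_assoc, div_self hn₀C, mul_one] at h
    exact h
  choose X hX𝔤 hXk hXj using key
  refine ⟨Θ - ∑ k, X k, Submodule.sub_mem _ hΘ𝔤 (Submodule.sum_mem _ fun k _ => hX𝔤 k), fun k w hw => ?_⟩
  rw [LinearMap.sub_apply, LinearMap.sum_apply, Finset.sum_eq_single k, hXk k w hw, sub_sub_cancel]
  · intro j _ hjk
    exact hXj j k (Ne.symm hjk) w hw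
  · intro h; exact absurd (Finset.mem_univ k) h

/-! ### §2 The `SU`-socket: lifts plus the `Θ`-direction give every operator with `Θ`-proportional block traces -/

/-- **THE `Hg = U_E ∩ SU`-SOCKET (Lie form, general CM type).** In the setting of §1 (`E = ℚ[φ]`, CM type `μ` with blocks of
dimension `n₀ ≠ 0` spanning `V_ℂ` together with their conjugates, admissible `𝔤 ∋ Θ_ℂ` with the LIFT property): every
`φ_ℂ`-commuting `ψ_ℂ`-skew operator `Y` of `V_ℂ` whose block traces are a common multiple of those of `Θ` —
`tr(Y|_{W_{μ k}}) = λ · (dim W_{μ k}^{1,0} − dim W_{μ k}^{0,1})` for all `k` — lies in `𝔤_ℂ`: `Y = Σ_k X_k + λ n₀⁻¹… C` on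
every `W_{μ k}` (`X_k` the lift of the traceless part of `Y|_{W_{μ k}}`, `C` the `Θ`-direction of §1), and an operator commuting
with `φ_ℂ`, `ψ_ℂ`-skew and zero on the CM type is zero (`CMThetaSocket.eq_zero_of_forall_eigenspace`).
[cite: MoonenZarhin1998WeilClasses, §4 Remark (1)] [cite: MoonenZarhin1999LowDim, §2 (2.3)]
[cite: Deligne1982HodgeCycles, I §3 Prop. 3.4 and §4] [cite: Ribet1983, Thm. 0] -/
theorem CMThetaSocket.mem_spanC_of_lift_of_trace_eq_smul [Module.Finite ℚ V] [HodgeTensorFacts.{u, u}] {ι : Type} [Fintype ι]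
    [DecidableEq ι] (H : HodgeStructure V n) (hn : n = 1) (heff : H.IsEffective) (ψ : H.Polarization)
    {φ : Module.End ℚ V} (hφE : φ ∈ H.endAlg) {m : ℕ} (hE : ∀ a ∈ H.endAlg, ∃ q : Fin m → ℚ, a = ∑ k, q k • φ ^ (k : ℕ))
    {n₀ : ℕ} (hn₀ : n₀ ≠ 0) (μ : ι → ℂ) (hinj : Function.Injective μ) (hdist : ∀ k k', μ k' ≠ starRingEnd ℂ (μ k))
    (hrank : ∀ k, Module.finrank ℂ ↥(Module.End.eigenspace (φ.baseChange ℂ) (μ k) ⊓ H.piece 1 0) +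
      Module.finrank ℂ ↥(Module.End.eigenspace (φ.baseChange ℂ) (μ k) ⊓ H.piece 0 1) = n₀)
    (htop : (⨆ kt : ι × Fin 2, Module.End.eigenspace (φ.baseChange ℂ)
      (if kt.2 = 0 then μ kt.1 else starRingEnd ℂ (μ kt.1))) = ⊤)
    (𝔤 : Submodule ℚ (Module.End ℚ V))
    (hcomm : ∀ X ∈ 𝔤, ∀ a : H.endAlg, X * (a : Module.End ℚ V) = (a : Module.End ℚ V) * X)
    (hskew : ∀ X ∈ 𝔤, ∀ v w, ψ.form (X v) w + ψ.form v (X w) = 0)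
    {Θ : Module.End ℂ (ℂ ⊗[ℚ] V)} (hΘ : ∀ p, ∀ x ∈ H.piece p (n - p), Θ x = ((2 * p - n : ℤ) : ℂ) • x)
    (hΘ𝔤 : Θ ∈ spanC 𝔤)
    (hlift : ∀ k, ∀ Z : Module.End ℂ ↥(Module.End.eigenspace (φ.baseChange ℂ) (μ k)),
      LinearMap.trace ℂ _ Z = 0 → ∃ X ∈ spanC 𝔤,
        (∀ w : ↥(Module.End.eigenspace (φ.baseChange ℂ) (μ k)), X w = Z w) ∧
        ∀ j, j ≠ k → ∀ w ∈ Module.End.eigenspace (φ.baseChange ℂ) (μ j), X w = 0)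
    {Y : Module.End ℂ (ℂ ⊗[ℚ] V)} (hYφ : Y * φ.baseChange ℂ = φ.baseChange ℂ * Y)
    (hYskew : ∀ x y, ψ.form.baseChange ℂ (Y x) y + ψ.form.baseChange ℂ x (Y y) = 0)
    (hYtr : ∃ c : ℂ, ∀ k, LinearMap.trace ℂ _ (Y.restrict fun x
        (hx : x ∈ Module.End.eigenspace (φ.baseChange ℂ) (μ k)) => UnitaryTheta.apply_mem_eigenspace_of_commute hYφ hx) =
      c * (((Module.finrank ℂ ↥(Module.End.eigenspace (φ.baseChange ℂ) (μ k) ⊓ H.piece 1 0) : ℂ) -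
        (Module.finrank ℂ ↥(Module.End.eigenspace (φ.baseChange ℂ) (μ k) ⊓ H.piece 0 1) : ℂ)))) :
    Y ∈ spanC 𝔤 := by
  classical
  set F := φ.baseChange ℂ with hF
  have hYW : ∀ k, ∀ w ∈ Module.End.eigenspace F (μ k), Y w ∈ Module.End.eigenspace F (μ k) := fun k w hw =>
    UnitaryTheta.apply_mem_eigenspace_of_commute hYφ hw
  have hfin : ∀ k, Module.finrank ℂ ↥(Module.End.eigenspace F (μ k)) = n₀ := fun k => by
    rw [hF, CMTheta.finrank_eigenspace_eq_add H hn heff hφE, hrank k]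
  have hn₀C : (n₀ : ℂ) ≠ 0 := Nat.cast_ne_zero.2 hn₀
  obtain ⟨c, hc⟩ := hYtr
  obtain ⟨C, hC𝔤, hC⟩ := CMThetaSocket.exists_centre_of_theta H hn heff hφE hn₀ μ hrank 𝔤 hcomm hΘ hΘ𝔤 hlift
  -- on each `W_{μ k}`: lift the traceless part of `Y|_{W_{μ k}}`
  have key : ∀ k, ∃ X ∈ spanC 𝔤, (∀ w ∈ Module.End.eigenspace F (μ k),
      X w = Y w - (LinearMap.trace ℂ _ (Y.restrict (hYW k)) / (n₀ : ℂ)) • w) ∧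
      ∀ j, j ≠ k → ∀ w ∈ Module.End.eigenspace F (μ j), X w = 0 := by
    intro k
    have hd : (Module.finrank ℂ ↥(Module.End.eigenspace F (μ k)) : ℂ) ≠ 0 := by rw [hfin k]; exact hn₀C
    set Z : Module.End ℂ ↥(Module.End.eigenspace F (μ k)) :=
      Y.restrict (hYW k) - (LinearMap.trace ℂ _ (Y.restrict (hYW k)) /
        (Module.finrank ℂ ↥(Module.End.eigenspace F (μ k)) : ℂ)) • 1 with hZ
    obtain ⟨X, hX𝔤, hXk, hXj⟩ := hlift k Z (CMThetaSocket.trace_sub_div_smul_one hd _)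
    refine ⟨X, hX𝔤, fun w hw => ?_, hXj⟩
    have h := hXk ⟨w, hw⟩
    rw [hZ, LinearMap.sub_apply, LinearMap.smul_apply, Module.End.one_apply, Submodule.coe_sub, Submodule.coe_smul,
      LinearMap.coe_restrict_apply, hfin k] at h
    exact h
  choose X hX𝔤 hXk hXj using key
  set S : Module.End ℂ (ℂ ⊗[ℚ] V) := (∑ k, X k) + c • C with hS
  have hS𝔤 : S ∈ spanC 𝔤 := Submodule.add_mem _ (Submodule.sum_mem _ fun k _ => hX𝔤 k) (Submodule.smul_mem _ _ hC𝔤)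
  -- `S = Y` on every `W_{μ k}`
  have hSY : ∀ k, ∀ w ∈ Module.End.eigenspace F (μ k), S w = Y w := by
    intro k w hw
    rw [hS, LinearMap.add_apply, LinearMap.sum_apply, Finset.sum_eq_single k, hXk k w hw, LinearMap.smul_apply, hC k w hw,
      smul_smul, hc k, mul_div_assoc, sub_add_cancel]
    · intro j _ hjk
      exact hXj j k (Ne.symm hjk) w hw
    · intro h; exact absurd (Finset.mem_univ k) h
  -- `S − Y` is `φ_ℂ`-commuting, `ψ_ℂ`-skew and zero on the CM type, hence zero
  have hD := CMThetaSocket.eq_zero_of_forall_eigenspace H hn heff ψ hφE hE μ hinj hdist htop (D := S - Y)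
    (by rw [sub_mul, mul_sub, UnitaryTheta.commute_of_mem_spanC H hφE hcomm hS𝔤, hYφ])
    (fun x y => by
      have h3 := ThetaSubalgebra.formBaseChange_add_eq_zero_of_mem_spanC ψ hskew hS𝔤 x y
      have h4 := hYskew x y
      rw [LinearMap.sub_apply, LinearMap.sub_apply, map_sub, LinearMap.sub_apply, map_sub]
      linear_combination h3 - h4)
    (fun k w hw => by rw [LinearMap.sub_apply, hSY k w hw, sub_self])
  rw [sub_eq_zero] at hD
  exact hD ▸ hS𝔤

/-- **THE `Hg = U_E ∩ SU_K`-SOCKET FOR TWO PLACES** (the `K`-Weil pattern of TABLE X row 11): `ι = {k₁, k₂}`, the setting of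
`CMThetaSocket.mem_spanC_of_lift_of_trace_eq_smul`, and the `Θ`-traces of the two blocks OPPOSITE and NON-ZERO
(`(dim W₁^{1,0} − dim W₁^{0,1}) + (dim W₂^{1,0} − dim W₂^{0,1}) = 0`, `dim W₁^{1,0} ≠ dim W₁^{0,1}`; e.g. Hodge types `(2|1)`,
`(1|2)`). Then every `φ_ℂ`-commuting `ψ_ℂ`-skew `Y` with `tr(Y|_{W_{μ k₁}}) + tr(Y|_{W_{μ k₂}}) = 0` lies in `𝔤_ℂ` — «`Lie Hg ⊗ ℂ ⊇
𝔲_E ∩ 𝔰𝔲_K`» GIVEN the lifts, the displayed Lie hypothesis `hSU` of the cell's B5a-E socket read on Hodge structures.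
[cite: MoonenZarhin1998WeilClasses, §4 Remark (1)] [cite: MoonenZarhin1999LowDim, §2 (2.3)]
[cite: Deligne1982HodgeCycles, I §3 Prop. 3.4 and §4] -/
theorem CMThetaSocket.mem_spanC_of_lift_of_trace_add_eq_zero [Module.Finite ℚ V] [HodgeTensorFacts.{u, u}] {ι : Type}
    [Fintype ι] [DecidableEq ι] (H : HodgeStructure V n) (hn : n = 1) (heff : H.IsEffective) (ψ : H.Polarization)
    {φ : Module.End ℚ V} (hφE : φ ∈ H.endAlg) {m : ℕ} (hE : ∀ a ∈ H.endAlg, ∃ q : Fin m → ℚ, a = ∑ k, q k • φ ^ (k : ℕ))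
    {n₀ : ℕ} (hn₀ : n₀ ≠ 0) (μ : ι → ℂ) (hinj : Function.Injective μ) (hdist : ∀ k k', μ k' ≠ starRingEnd ℂ (μ k))
    (hrank : ∀ k, Module.finrank ℂ ↥(Module.End.eigenspace (φ.baseChange ℂ) (μ k) ⊓ H.piece 1 0) +
      Module.finrank ℂ ↥(Module.End.eigenspace (φ.baseChange ℂ) (μ k) ⊓ H.piece 0 1) = n₀)
    (htop : (⨆ kt : ι × Fin 2, Module.End.eigenspace (φ.baseChange ℂ)
      (if kt.2 = 0 then μ kt.1 else starRingEnd ℂ (μ kt.1))) = ⊤)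
    (𝔤 : Submodule ℚ (Module.End ℚ V))
    (hcomm : ∀ X ∈ 𝔤, ∀ a : H.endAlg, X * (a : Module.End ℚ V) = (a : Module.End ℚ V) * X)
    (hskew : ∀ X ∈ 𝔤, ∀ v w, ψ.form (X v) w + ψ.form v (X w) = 0)
    {Θ : Module.End ℂ (ℂ ⊗[ℚ] V)} (hΘ : ∀ p, ∀ x ∈ H.piece p (n - p), Θ x = ((2 * p - n : ℤ) : ℂ) • x)
    (hΘ𝔤 : Θ ∈ spanC 𝔤)
    (hlift : ∀ k, ∀ Z : Module.End ℂ ↥(Module.End.eigenspace (φ.baseChange ℂ) (μ k)),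
      LinearMap.trace ℂ _ Z = 0 → ∃ X ∈ spanC 𝔤,
        (∀ w : ↥(Module.End.eigenspace (φ.baseChange ℂ) (μ k)), X w = Z w) ∧
        ∀ j, j ≠ k → ∀ w ∈ Module.End.eigenspace (φ.baseChange ℂ) (μ j), X w = 0)
    (k₁ k₂ : ι) (hk : k₁ ≠ k₂) (hι : ∀ k, k = k₁ ∨ k = k₂)
    (ht : ((Module.finrank ℂ ↥(Module.End.eigenspace (φ.baseChange ℂ) (μ k₁) ⊓ H.piece 1 0) : ℤ) -
        Module.finrank ℂ ↥(Module.End.eigenspace (φ.baseChange ℂ) (μ k₁) ⊓ H.piece 0 1)) +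
      ((Module.finrank ℂ ↥(Module.End.eigenspace (φ.baseChange ℂ) (μ k₂) ⊓ H.piece 1 0) : ℤ) -
        Module.finrank ℂ ↥(Module.End.eigenspace (φ.baseChange ℂ) (μ k₂) ⊓ H.piece 0 1)) = 0)
    (ht₁ : Module.finrank ℂ ↥(Module.End.eigenspace (φ.baseChange ℂ) (μ k₁) ⊓ H.piece 1 0) ≠
      Module.finrank ℂ ↥(Module.End.eigenspace (φ.baseChange ℂ) (μ k₁) ⊓ H.piece 0 1))
    {Y : Module.End ℂ (ℂ ⊗[ℚ] V)} (hYφ : Y * φ.baseChange ℂ = φ.baseChange ℂ * Y)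
    (hYskew : ∀ x y, ψ.form.baseChange ℂ (Y x) y + ψ.form.baseChange ℂ x (Y y) = 0)
    (hYtr : LinearMap.trace ℂ _ (Y.restrict fun x (hx : x ∈ Module.End.eigenspace (φ.baseChange ℂ) (μ k₁)) =>
        UnitaryTheta.apply_mem_eigenspace_of_commute hYφ hx) +
      LinearMap.trace ℂ _ (Y.restrict fun x (hx : x ∈ Module.End.eigenspace (φ.baseChange ℂ) (μ k₂)) =>
        UnitaryTheta.apply_mem_eigenspace_of_commute hYφ hx) = 0) :
    Y ∈ spanC 𝔤 := by
  classical
  set F := φ.baseChange ℂ with hF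
  -- the block signatures `t k = dim W_k^{1,0} − dim W_k^{0,1}` (as complex numbers)
  set t : ι → ℂ := fun k => ((Module.finrank ℂ ↥(Module.End.eigenspace F (μ k) ⊓ H.piece 1 0) : ℂ) -
    (Module.finrank ℂ ↥(Module.End.eigenspace F (μ k) ⊓ H.piece 0 1) : ℂ)) with htdef
  have ht₁' : t k₁ ≠ 0 := by
    rw [htdef]; simp only
    rw [sub_ne_zero, Ne, Nat.cast_inj]
    exact ht₁
  have ht' : t k₁ + t k₂ = 0 := by
    have h := congrArg (fun z : ℤ => (z : ℂ)) ht
    simp only [Int.cast_add, Int.cast_sub, Int.cast_natCast, Int.cast_zero] at h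
    rw [htdef]
    exact h
  set y₁ := LinearMap.trace ℂ _ (Y.restrict fun x (hx : x ∈ Module.End.eigenspace F (μ k₁)) =>
    UnitaryTheta.apply_mem_eigenspace_of_commute hYφ hx) with hy₁
  refine CMThetaSocket.mem_spanC_of_lift_of_trace_eq_smul H hn heff ψ hφE hE hn₀ μ hinj hdist hrank htop 𝔤 hcomm hskew hΘ
    hΘ𝔤 hlift hYφ hYskew ⟨y₁ / t k₁, fun k => ?_⟩
  rcases hι k with rfl | rfl
  · change y₁ = y₁ / t k * t k
    rw [div_mul_cancel₀ _ ht₁']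
  · have h2 : t k = -t k₁ := eq_neg_of_add_eq_zero_right ht'
    change LinearMap.trace ℂ _ (Y.restrict fun x (hx : x ∈ Module.End.eigenspace F (μ k)) =>
      UnitaryTheta.apply_mem_eigenspace_of_commute hYφ hx) = y₁ / t k₁ * t k
    rw [h2, mul_neg, div_mul_cancel₀ _ ht₁']
    exact eq_neg_of_add_eq_zero_right (by rw [hy₁] at hYtr; exact hYtr)

end HodgeStructure

end Literature.AlgebraicGeometry.Motives

end
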